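import Summits.QuantumFields.BalabanUV.T4Continuum.Spine.NE1p.DressedRootWitness

/-!
# T⁴ programme, spine estimate NE1′ (node O3b/H2) — SEPARATION WITNESS: per-cutoff stability at EVERY cutoff is NOT the row
# root; the quantifier order `∃ (A₀ ρ₁ τ), ∀ p K` is the content (trigger caveat k1, in kernel)

Cell `pub-balaban`, sub-cell `t4`, BINDER-OWNERS row NE1′, formalisation crew `b2b-balaban-t4-ne1p-formalise-*`, seat
`…-leaf-07` (gen 2; own-initiative witness item «W4», journal `CLAIMS.log` INTENT NE1p-W4).  ADDITIVE — imports
`Spine/NE1p/DressedRootWitness` (p211675; the positive toy `toyTower` ∕ `toyBooking`) ONLY, modifies nothing.  No `def … : Prop`;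
the three `def`s are toy DATA (a booking, a trajectory, a tower).

WHY THIS FILE.  The row root `DressedRoot.DressedStability 𝒯 := ∃ A₀ ρ₁ τ, … ∧ ∀ p K, ClassAt (𝒯.B p K) A₀ ρ₁ τ` differs from the
UNDRESSED statement «at every cutoff and run parameter the booked terms lie in SOME two-rate class» ONLY by the order of the
quantifiers; RULING R-t4r2-Q2 and trigger caveat k1 say that this order IS the content («any constant that depends on K or on μ
turns the root into the undressed statement — reject such a `UniformConstants` at XREAD»).  This file makes the difference a
kernel fact on a decided toy, and reads the uniform content back out of the root as a NECESSARY condition: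

* §1 NECESSITY [bookkeeping]: `DressedStabilityWith 𝒯 A₀ ρ₁ τ` forces every booked BIRTH size, at every cutoff and run parameter,
  to be `≤ A₀` (`size_birth_le_of_dressedStabilityWith`); hence `DressedStability 𝒯 → ∃ A₀, ∀ p K b, size b (birthScale b) ≤ A₀`
  (`births_bounded_of_dressedStability`) — K- and μ-UNIFORM boundedness of the births is necessary; with `ρ₁ ≤ 1` every booked
  size is `≤ A₀` (`size_le_of_dressedStabilityWith`).
* §2 THE SEPARATING TOWER [decided toy]: `undressedTower` — one family per cutoff, born at scale 0, booked size `K + 1` at every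
  scale of the cutoff-`K` run.  Per cutoff it IS in a two-rate class, with the cutoff-dependent amplitude `A₀ = K + 1`
  (`classAt_undressed`, `perCutoff_undressed : ∀ p K, ∃ A₀ ρ₁ τ, … ∧ ClassAt (undressedTower.B p K) A₀ ρ₁ τ`), yet
  `not_dressedStability_undressed : ¬ DressedStability undressedTower` (Archimedes on the births).  So
  `perCutoff_not_imp_dressed`: «∀ p K ∃ constants» does NOT imply «∃ constants ∀ p K» on dressed towers — while the positive toy
  `DressedRootWitness.toyTower` has both.
* §3 THROUGH END-B [bookkeeping]: no single `U : UniformConstants` serves leaf bundles `BookingLeaves U …` of the separating tower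
  at every cutoff (`no_uniformConstants_undressed`, contrapositive of `dressedStability_of_bookingLeaves`) — the kernel form of
  k1's XREAD instruction.

HONEST FRAMING.  A decided toy about QUANTIFIER ORDER plus two unfolding lemmas; nothing of Bałaban's densities or of
[Balaban1989LargeFieldII] is encoded; [folklore]-free own bookkeeping, 0 sorry, 0 citations.  NE1′ ⇐ the named binders, NOT
proved; the wall (w1), (w2-act), (w3)⁺, (w5), F-6's rate stands DISPLAYED; 0 leaves instantiated on Bałaban's densities; spine
PROVED 0∕9.  Rung (B)+1 on ONE finite four-torus — NOT infinite volume, NOT a mass gap, NOT OS on ℝ⁴, NOT Clay.  HONEST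
DEPENDENCY: continuum YM on T⁴ ⇐ BetaPertH ∧ nine spine estimates (0/9 proved); BetaPertH ⇐ (D1) ∧ (D4) ∧ CAP+tail; G-an2-4
gates asym, D1 and NE2/3/4.
-/

noncomputable section

namespace Summit.QuantumFields.BalabanUV.T4Continuum.NE1p.DressedRootSeparation

open Finset
open scoped BigOperators
open Literature.MathematicalPhysics.QuantumFieldTheory.Balaban1983to89
open Literature.MathematicalPhysics.QuantumFieldTheory.Balaban1983to89.T4TermFormat
open Literature.MathematicalPhysics.QuantumFieldTheory.Balaban1983to89.T4TermFormat.Booking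
open Literature.MathematicalPhysics.QuantumFieldTheory.Balaban1983to89.T4TrajectoryComparison
open Summit.QuantumFields.BalabanUV.T4Continuum.T4TrajectoryDensityDressed
open Summit.QuantumFields.BalabanUV.T4Continuum.NE1p.DressedRoot

/-! ## §1 Necessity: the root bounds the births uniformly in the cutoff and the run parameter -/

/-- **NECESSITY — UNIFORMLY BOUNDED BIRTHS** [bookkeeping]: under `DressedStabilityWith 𝒯 A₀ ρ₁ τ` every booked term's size AT
ITS BIRTH SCALE is `≤ A₀`, at every cutoff `K` and every run parameter `p` (the class gives `≤ A₀·ρ₁⁰·τ^{K−j} ≤ A₀` since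
`0 ≤ τ ≤ 1`). -/
theorem size_birth_le_of_dressedStabilityWith {P : Type*} {𝒯 : DressedTower P} {A₀ ρ₁ τ : ℝ}
    (h : DressedStabilityWith 𝒯 A₀ ρ₁ τ) (p : P) (K : ℕ) (b : (𝒯.B p K).Birth) :
    (𝒯.B p K).size b ((𝒯.B p K).birthScale b) ≤ A₀ := by
  obtain ⟨hA₀, _, hτ0, hτ1, hcl⟩ := h
  have h1 := hcl p K b ((𝒯.B p K).birthScale b) le_rfl ((𝒯.B p K).birth_le b)
  simp only [twoRate, Nat.sub_self, pow_zero, mul_one] at h1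
  exact h1.trans (mul_le_of_le_one_right hA₀ (pow_le_one₀ hτ0 hτ1))

/-- **NECESSITY, existential form** [bookkeeping]: `DressedStability 𝒯` ⟹ ONE number bounds all booked birth sizes of all cutoffs
and all run parameters — the K-∕μ-uniform content of the root read back out of it. -/
theorem births_bounded_of_dressedStability {P : Type*} {𝒯 : DressedTower P} (h : DressedStability 𝒯) :
    ∃ A₀ : ℝ, ∀ (p : P) (K : ℕ) (b : (𝒯.B p K).Birth), (𝒯.B p K).size b ((𝒯.B p K).birthScale b) ≤ A₀ := by
  obtain ⟨A₀, ρ₁, τ, hW⟩ := h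
  exact ⟨A₀, fun p K b => size_birth_le_of_dressedStabilityWith hW p K b⟩

/-- With a family factor `ρ₁ ≤ 1` the root bounds EVERY booked size (not only the births) by `A₀`. [bookkeeping] -/
theorem size_le_of_dressedStabilityWith {P : Type*} {𝒯 : DressedTower P} {A₀ ρ₁ τ : ℝ}
    (h : DressedStabilityWith 𝒯 A₀ ρ₁ τ) (hρ₁ : ρ₁ ≤ 1) (p : P) (K : ℕ) (b : (𝒯.B p K).Birth) {k : ℕ}
    (hbk : (𝒯.B p K).birthScale b ≤ k) (hk : k ≤ (𝒯.B p K).K) : (𝒯.B p K).size b k ≤ A₀ := by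
  obtain ⟨hA₀, hρ0, hτ0, hτ1, hcl⟩ := h
  have h1 := hcl p K b k hbk hk
  unfold twoRate at h1
  have h2 : A₀ * ρ₁ ^ (k - (𝒯.B p K).birthScale b) * τ ^ ((𝒯.B p K).K - (𝒯.B p K).birthScale b) ≤ A₀ := by
    have hp1 : ρ₁ ^ (k - (𝒯.B p K).birthScale b) ≤ 1 := pow_le_one₀ hρ0 hρ₁
    have hp2 : τ ^ ((𝒯.B p K).K - (𝒯.B p K).birthScale b) ≤ 1 := pow_le_one₀ hτ0 hτ1
    calc A₀ * ρ₁ ^ (k - (𝒯.B p K).birthScale b) * τ ^ ((𝒯.B p K).K - (𝒯.B p K).birthScale b)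
        ≤ A₀ * 1 * 1 := by gcongr
      _ = A₀ := by ring
  exact h1.trans h2

/-! ## §2 The separating tower: per-cutoff stability at every cutoff, but not the root -/

/-- **THE SEPARATING BOOKING at cutoff `K`** [decided toy]: the positive toy's booking (`DressedRootWitness.toyBooking`: one family,
born at scale `0`, one cube per scale) with the booked size replaced by the CUTOFF-DEPENDENT constant `K + 1` at every scale. -/
def undressedBooking (K : ℕ) : T4TermFormat.Booking :=
  { toyBooking K with
    size := fun _ _ => (K : ℝ) + 1
    size_nonneg := fun _ _ => by positivity }

/-- Field read-out: the cutoff. -/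
@[simp] theorem undressedBooking_K (K : ℕ) : (undressedBooking K).K = K := rfl

/-- Field read-out: the birth scale is `0`. -/
@[simp] theorem undressedBooking_birthScale (K : ℕ) (b : (undressedBooking K).Birth) :
    (undressedBooking K).birthScale b = 0 := rfl

/-- Field read-out: the booked size is `K + 1` at every scale. -/
@[simp] theorem undressedBooking_size (K : ℕ) (b : (undressedBooking K).Birth) (k : ℕ) :
    (undressedBooking K).size b k = (K : ℝ) + 1 := rfl

/-- **THE SEPARATING TRAJECTORY** [decided toy]: one generation (the birth, of size `K + 1`), re-linearised size = booked size. -/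
def undressedTrajectory (K : ℕ) : Trajectory (undressedBooking K) where
  lin := fun _ k' _ => if k' = 0 then (K : ℝ) + 1 else 0
  lin_nonneg := fun _ k' _ => by split_ifs <;> positivity
  gen := fun _ k' => if k' = 0 then (K : ℝ) + 1 else 0
  gen_nonneg := fun _ k' => by split_ifs <;> positivity
  size_le := fun b k _ _ => by
    show (K : ℝ) + 1 ≤ ∑ k' ∈ Icc 0 k, (if k' = 0 then (K : ℝ) + 1 else 0)
    rw [Finset.sum_ite_eq' (Icc 0 k) 0 (fun _ => (K : ℝ) + 1)]
    simp

/-- **THE SEPARATING TOWER** [decided toy]: the separating booking and trajectory at every cutoff, one run parameter. -/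
def undressedTower : DressedTower Unit where
  B := fun _ K => undressedBooking K
  K_eq := fun _ _ => rfl
  T := fun _ K => undressedTrajectory K

/-- **PER-CUTOFF STABILITY HOLDS, WITH A CUTOFF-DEPENDENT AMPLITUDE** [decided toy]: at cutoff `K` the separating booking lies in
the two-rate class with `A₀ = K + 1`, `ρ₁ = τ = 1`. -/
theorem classAt_undressed (K : ℕ) : ClassAt (undressedBooking K) ((K : ℝ) + 1) 1 1 := by
  intro b k _ _
  simp [twoRate]

/-- **THE UNDRESSED STATEMENT HOLDS FOR THE SEPARATING TOWER** [decided toy]: at EVERY run parameter and cutoff there ARE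
admissible constants (`0 ≤ A₀`, `0 ≤ ρ₁`, `0 ≤ τ ≤ 1`) putting the booked terms in the two-rate class — the constants chosen
AFTER `K`. -/
theorem perCutoff_undressed : ∀ (p : Unit) (K : ℕ), ∃ A₀ ρ₁ τ : ℝ,
    0 ≤ A₀ ∧ 0 ≤ ρ₁ ∧ 0 ≤ τ ∧ τ ≤ 1 ∧ ClassAt (undressedTower.B p K) A₀ ρ₁ τ :=
  fun _ K => ⟨(K : ℝ) + 1, 1, 1, by positivity, zero_le_one, zero_le_one, le_rfl, classAt_undressed K⟩

/-- **… BUT THE ROW ROOT FAILS** [decided toy]: `¬ DressedStability undressedTower` — a uniform `A₀` would bound the birth size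
`K + 1` of the cutoff-`K` run for every `K` (§1), impossible at `K = ⌈A₀⌉₊`. -/
theorem not_dressedStability_undressed : ¬ DressedStability undressedTower := by
  intro h
  obtain ⟨A₀, hA⟩ := births_bounded_of_dressedStability h
  have h1 := hA () ⌈A₀⌉₊ ()
  simp only [undressedTower, undressedBooking_birthScale, undressedBooking_size] at h1
  have h2 : A₀ ≤ (⌈A₀⌉₊ : ℝ) := Nat.le_ceil A₀
  linarith

/-- **SEPARATION** [decided toy]: on dressed towers, «at every run parameter and cutoff SOME admissible two-rate class contains the
booked terms» does NOT imply `DressedStability` — the quantifier order `∃ (A₀ ρ₁ τ), ∀ p K` of the row root (RULING R-t4r2-Q2,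
caveat k1) is genuine content.  (The positive toy `DressedRootWitness.toyTower` satisfies both.) -/
theorem perCutoff_not_imp_dressed :
    ¬ (∀ (𝒯 : DressedTower Unit),
        (∀ (p : Unit) (K : ℕ), ∃ A₀ ρ₁ τ : ℝ, 0 ≤ A₀ ∧ 0 ≤ ρ₁ ∧ 0 ≤ τ ∧ τ ≤ 1 ∧ ClassAt (𝒯.B p K) A₀ ρ₁ τ) →
          DressedStability 𝒯) :=
  fun h => not_dressedStability_undressed (h undressedTower perCutoff_undressed)

/-! ## §3 Through END-B: no cutoff-free `UniformConstants` serves the separating tower -/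

/-- **NO K-FREE CONSTANTS FOR THE SEPARATING TOWER** [bookkeeping]: there is no single `U : UniformConstants` whose leaf bundle
`BookingLeaves U …` is inhabited at every cutoff of the separating tower — else END-B `dressedStability_of_bookingLeaves` would give
the root, contradicting §2.  This is caveat k1's XREAD instruction as a kernel fact: constants serving every cutoff of a tower whose
births grow with the cutoff do not exist. -/
theorem no_uniformConstants_undressed :
    ¬ ∃ U : UniformConstants, ∀ K : ℕ, Nonempty (BookingLeaves U (undressedBooking K) (undressedTrajectory K)) := by
  rintro ⟨U, hU⟩
  exact not_dressedStability_undressed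
    (dressedStability_of_bookingLeaves U undressedTower fun _ K => (hU K).some)

/-- Conversely the positive toy of `DressedRootWitness` has BOTH the per-cutoff statement and the root (recorded for contrast;
`dressedStability_toyTower` by name). [decided toy] -/
theorem toyTower_both :
    (∀ (p : Unit) (K : ℕ), ∃ A₀ ρ₁ τ : ℝ, 0 ≤ A₀ ∧ 0 ≤ ρ₁ ∧ 0 ≤ τ ∧ τ ≤ 1 ∧ ClassAt (toyTower.B p K) A₀ ρ₁ τ) ∧
      DressedStability toyTower := by
  refine ⟨fun p K => ?_, dressedStability_toyTower⟩
  obtain ⟨A₀, ρ₁, τ, hA₀, hρ₁, hτ0, hτ1, hcl⟩ := dressedStability_toyTower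
  exact ⟨A₀, ρ₁, τ, hA₀, hρ₁, hτ0, hτ1, hcl p K⟩

end Summit.QuantumFields.BalabanUV.T4Continuum.NE1p.DressedRootSeparation

end
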